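import Mathlib
import HarnessLib
import Literature.NumberTheory.Automorphic.ACCAutomorphyLiftingCrystalline

/-!
# Route `RamifiedCoefficientSeed`, crux `AdjointLiftingGL3` (stmt-Langlands-16779), line `birth`:
# stub `stub_automorphyLifting` (skeleton v2) from the named fact
# `ACCGHLNSTT2023.automorphyLifting_crystalline_weightZero`

The line's Fontaine–Laffaille automorphy lifting step: ACC+ 2023 (Allen–Calegari–Caraiani–Gee–
Helm–Le Hung–Newton–Scholze–Taylor–Thorne, *Potential automorphy over CM fields*, Ann. of Math. 197
(2023)), Theorem 6.1.1 in weight `λ = 0`, SPECIALISED to `F = ℚ`, `n = 3`, `p ≥ 11`, as a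
CONDITIONAL result: its first hypothesis is the vendored named fact
`Literature.NumberTheory.Automorphic.ACCGHLNSTT2023.automorphyLifting_crystalline_weightZero`
(the weight-zero member of Thm. 6.1.1 for every totally real or CM `F` and every `n`), and the
stub is that fact instantiated:

* `F := ℚ` is totally real (Mathlib instance `IsTotallyReal ℚ`), so `IsTotallyReal ℚ ∨ IsCMField ℚ`;
* `n := 3`: `3 ^ 2 = 9 < p` and `2 * 3 = 6 < p` from `11 ≤ p`;
* `p` is unramified in `ℚ`: `Algebra.IsUnramifiedIn (𝓞 ℚ) (Ideal.span {(p : ℤ)})` from Dedekind's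
  discriminant theorem (Mathlib `NumberField.not_dvd_discr_iff_isUnramifiedIn`) and `discr ℚ = 1`
  (`NumberField.discr_rat`) — `isUnramifiedIn_ringOfIntegers_rat`;
* the Hodge–Tate clause: the fact asks for `HT_{τ'}(ρ) = (Multiset.range 3).map Nat.cast`, the
  stub for `HT_{τ'}(ρ) = {0, 1, 2}`; these multisets are equal (`multisetRange_three_map_natCast`);
* the fact's conclusion carries two extra unramifiedness clauses for `Π_v`, which are dropped.

The statement is the registered stub signature verbatim (the `let D := …;` / `letI := D.algebra;`
separators are written with `;` so that the header is also a well-formed ONE-LINE term — the form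
under which the stub is registered on the crux item; the elaborated statement is identical to the
skeleton's newline layout).

References: [ACCGHLNSTT2023] P. B. Allen et al., *Potential automorphy over CM fields*, Ann. of
Math. (2) 197 (2023), 897–1113, Thm. 6.1.1 (weight `λ = 0`).
-/

set_option linter.dupNamespace false

noncomputable section

namespace Summit.Langlands.Langlands.Cruxes.AdjointLiftingGL3.Birth

open scoped MatrixGroups NumberField
open NumberField IsDedekindDomain Field Filter
open Literature.NumberTheory.GaloisRepresentations Literature.NumberTheory.PAdicHodge
open Literature.NumberTheory.Automorphic

/-! ## Elementary inputs at `F = ℚ`, `n = 3` -/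

/-- The weight-zero Hodge–Tate multiset of the fact at `n = 3` is `{0, 1, 2}`:
`(Multiset.range 3).map Nat.cast = {0, 1, 2}` in `Multiset ℤ`. [folklore] -/
theorem multisetRange_three_map_natCast :
    ((Multiset.range 3).map fun i : ℕ => (i : ℤ)) = {0, 1, 2} := by
  decide

/-- Every rational prime `p` is unramified in `ℚ`: the ideal `(p) ⊂ ℤ` is unramified in `𝓞 ℚ`
(Dedekind: `p ∤ discr ℚ = 1`). [folklore] -/
theorem isUnramifiedIn_ringOfIntegers_rat (p : ℕ) [hp : Fact p.Prime] :
    Algebra.IsUnramifiedIn (𝓞 ℚ) (Ideal.span {(p : ℤ)}) :=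
  (NumberField.not_dvd_discr_iff_isUnramifiedIn ℚ (𝓞 ℚ)
      (Nat.prime_iff_prime_int.mp hp.out)).mp (by
    rw [NumberField.discr_rat]
    exact fun h ↦ hp.out.one_lt.ne' (by exact_mod_cast Int.eq_one_of_dvd_one (by positivity) h))

/-! ## The registered stub (skeleton v2) -/

/-- **Stub `stub_automorphyLifting` (registered signature, verbatim; skeleton v2): ACC+ Thm. 6.1.1,
weight `λ = 0`, at `F = ℚ`, `n = 3`, `p ≥ 11`, CONDITIONAL on the vendored named fact
`ACCGHLNSTT2023.automorphyLifting_crystalline_weightZero` (its first hypothesis).**  Let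
`ρ : Γ_ℚ → GL₃(ℚ̄_p)` be unramified a.e. and crystalline at `p` with labelled Hodge–Tate weights
`{0,1,2}` (pinned Fontaine datum); let `τ` be a residual representation of `ρ` which is absolutely
irreducible and decomposed generic, with `τ|_{Γ_{ℚ(ζ_p)}}` absolutely irreducible of enormous image
and `τ σ` scalar for some `σ ∉ Γ_{ℚ(ζ_p)}`; let `π` be cuspidal of weight zero, unramified at `p`,
and `r` a framed representation with HLTT's characterising property of `r_ι(π)` and residual
representation `τ`.  Then there is a cuspidal `Π` of weight zero such that `ρ` has HLTT's
characterising property of `r_ι(Π)` (`ρ ≅ r_ι(Π)`).  Proof: instantiate the fact at `F := ℚ`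
(totally real), `n := 3` (`9 < p`, `6 < p`), `p` unramified in `ℚ`
(`isUnramifiedIn_ringOfIntegers_rat`), Hodge–Tate clause via `multisetRange_three_map_natCast`, and
drop the two unramifiedness clauses of its conclusion.
[cite: ACCGHLNSTT2023, Thm. 6.1.1 (weight λ = 0)] -/
theorem stub_automorphyLifting :
    ACCGHLNSTT2023.automorphyLifting_crystalline_weightZero →
    ∀ (p : ℕ) [Fact p.Prime], 11 ≤ p →
      ∀ (hcpt : isCompact_glFiniteIntegralLevel 3 ℚ) (ι : PadicAlgCl p ≃+* ℂ)
        (ρ : FramedGaloisRep ℚ (PadicAlgCl p) 3)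
        (τ : absoluteGaloisGroup ℚ →* GL (Fin 3) (padicAlgClResidueField p))
        (π : CuspidalAutomorphicRepData 3 ℚ hcpt) (r : FramedGaloisRep ℚ (PadicAlgCl p) 3),
        (∀ᶠ v : HeightOneSpectrum (𝓞 ℚ) in cofinite, ρ.IsUnramifiedAt v) →
        (∀ (v : HeightOneSpectrum (𝓞 ℚ)) (hv : ((p : ℕ) : 𝓞 ℚ) ∈ v.asIdeal),
          let D := fontainePstAdicCompletion v p hv;
          D.IsCrystallineFramed (ρ.toLocal v) ∧
            (letI := D.algebra;
             ∀ τ' : v.adicCompletion ℚ →ₐ[ℚ_[p]] PadicAlgCl p,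
               ρ.labelledHodgeTateWeightsAt v D.algebra D.𝔅 τ'.toRingHom = {0, 1, 2})) →
        ρ.IsResidualRepOf (RingHom.id _) τ → IsAbsIrreducible τ → IsDecomposedGeneric τ →
        IsAbsIrreducible (τ.comp (absGaloisGroupAdjoinRootsOfUnity ℚ p).subtype) →
        Subgroup.IsEnormous ((absGaloisGroupAdjoinRootsOfUnity ℚ p).map τ) →
        (∃ σ : absoluteGaloisGroup ℚ, σ ∉ absGaloisGroupAdjoinRootsOfUnity ℚ p ∧
          ∃ c : padicAlgClResidueField p,
            ((τ σ : GL (Fin 3) (padicAlgClResidueField p)) :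
              Matrix (Fin 3) (Fin 3) (padicAlgClResidueField p)) = c • (1 : Matrix _ _ _)) →
        π.1.HasWeightZero → HLTT.IsCompatible π.1 ι r →
        r.IsResidualRepOf (RingHom.id _) τ →
        (∀ v : HeightOneSpectrum (𝓞 ℚ), ((p : ℕ) : 𝓞 ℚ) ∈ v.asIdeal → π.1.IsUnramifiedAt v) →
        ∃ Pi : CuspidalAutomorphicRepData 3 ℚ hcpt,
          Pi.1.HasWeightZero ∧ HLTT.IsCompatible Pi.1 ι ρ := by
  intro hACC p _ hp hcpt ι ρ τ π r hunr hcrys hτ habs hdg habsζ henorm hscalar hw0 hcompat hr hunrp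
  -- `n = 3`: `n² < p` and `2n < p` from `11 ≤ p`
  have h9 : 3 ^ 2 < p := lt_of_lt_of_le (by norm_num) hp
  have h6 : 2 * 3 < p := lt_of_lt_of_le (by norm_num) hp
  -- the Hodge–Tate clause in the fact's form `(Multiset.range 3).map Nat.cast`
  have hcrys' : ∀ (v : HeightOneSpectrum (𝓞 ℚ)) (hv : ((p : ℕ) : 𝓞 ℚ) ∈ v.asIdeal),
      let D := fontainePstAdicCompletion v p hv;
      D.IsCrystallineFramed (ρ.toLocal v) ∧
        (letI := D.algebra;
         ∀ τ' : v.adicCompletion ℚ →ₐ[ℚ_[p]] PadicAlgCl p,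
           ρ.labelledHodgeTateWeightsAt v D.algebra D.𝔅 τ'.toRingHom =
             (Multiset.range 3).map fun i : ℕ => (i : ℤ)) := by
    intro v hv
    refine ⟨(hcrys v hv).1, fun τ' => ?_⟩
    have hM := (hcrys v hv).2 τ'
    rw [hM, multisetRange_three_map_natCast]
  -- ACC+ Thm. 6.1.1 (weight zero) at `F = ℚ` (totally real, `p` unramified), `n = 3`
  obtain ⟨Pi, hPiw, hPic, -, -⟩ :=
    hACC ℚ (Or.inl inferInstance) 3 hcpt p h9 h6 (isUnramifiedIn_ringOfIntegers_rat p) ι ρ τ π r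
      hunr hcrys' hτ habs hdg habsζ henorm hscalar hw0 hcompat hr hunrp
  exact ⟨Pi, hPiw, hPic⟩

end Summit.Langlands.Langlands.Cruxes.AdjointLiftingGL3.Birth

end
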